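import Literature.AnabelianGeometry.SemiGraphs.TemperedPiTreeCosetIso
import Literature.AnabelianGeometry.SemiGraphs.CovObjPointPresentationPush
import HarnessLib

/-!
# The finite levels `𝔾_{S n}` of the Galois tower are coset semi-graphs of `π₁^temp(𝒢)` ([SemiAnbd] Thm 3.7 (iii) p. 41)

Mochizuki, *Semi-graphs of anabelioids*, Publ. RIMS **42** (2006), §3, proof of Thm. 3.7 (iii) p. 41
("finite étale Galois coverings `𝒢_i → 𝒢` … with underlying semi-graphs `𝔾_i` … `𝒢_{∞,i} → 𝒢_i` the
universal graph-covering"; "natural maps `V_i → V_j`, `E_i → E_j`") and Prop. 3.6 p. 38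
("`Gal(𝒢_{∞,i}/𝒢) → Gal(𝒢_i/𝒢)`") [cite: MochizukiSemiAnbd2006, Thm 3.7(iii) p.41].

DICTIONARY, part 5 (cell row T54-B, tower third, file T3e-2; plan/GAP-LEDGER.md G-w4d053-1): for
abc-iut-L3-t9's Galois tower `D` (connected finite levels `hconn`) with point sequences `T` and reference
branches `R`, the FINITE levels: `π_n : π₁^temp(𝒢) ↠ Gal(𝒢_{∞,n}/𝒢) ↠ Aut(S n)` (`piLevelAut`, via
t9's `descendBaseAut`), the isomorphism of semi-graphs
`D.levelCosetIso n : (D.piPresentation T R).cosetGraph (ker π_n) ≅ (D.S n).orbitGraph`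
(`cosetGraphIsoTo` along `π_n` onto the point presentation of `S n` — part 3's `map_desc_H/M`,
`desc_brElt` — then part 2's `cosetGraphIsoOrbitGraph`).  PROVED: it lies over `𝔾`; the universal
graph-coverings `treeQuot n : 𝒢_{∞,n} → 𝔾_{S n}` of abc-iut-L3-t6 correspond to the transitions
`cosetGraphTrans (ker ρ_n ≤ ker π_n)` (`treeCosetIso_quot`, the `quot` dictionary); the deck action
corresponds to t6's `levelAct` (`deckAct_comp_levelCosetIso`); and the finite-level transitions
`𝔾(S (n+1) → S n)` correspond to `cosetGraphTrans (ker π_{n+1} ≤ ker π_n)` (`levelCosetIso_trans`,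
by cancelling the epimorphism `cosetGraphTrans` against the tree-level squares; `ker π_{n+1} ≤ ker π_n`
by rigidity and uniqueness of descent).  Nothing here bears on
[IUTchIII] Cor. 3.12.
-/

namespace Literature.AnabelianGeometry.SemiGraphs

open CategoryTheory

universe u

/-! ### Cancelling the transition epimorphisms of coset semi-graphs -/

namespace SemiGraph.SubgroupPresentation

variable {𝔾 : SemiGraph.{u}} {Γ : Type u} [Group Γ] (P : SubgroupPresentation 𝔾 Γ)

/-- The transition morphisms `cosetGraphTrans` are epimorphisms: they can be cancelled on the left.
[cite: MochizukiSemiAnbd2006, Thm 3.7(iii) p.41] -/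
theorem cancel_cosetGraphTrans {K K' : Subgroup Γ} (h : K ≤ K') {X : SemiGraph.{u}}
    (F G : P.cosetGraph K' ⟶ X) (hFG : P.cosetGraphTrans h ≫ F = P.cosetGraphTrans h ≫ G) : F = G :=
  P.hom_ext_mk K' F G
    (fun w y => congrArg (fun φ : P.cosetGraph K ⟶ X => φ.vertexMap (P.vMk K w y)) hFG)
    (fun e y => congrArg (fun φ : P.cosetGraph K ⟶ X => φ.edgeMap (P.eMk K e y)) hFG)
    (fun b y => congrArg (fun φ : P.cosetGraph K ⟶ X => φ.branchMap (P.bMk K b y)) hFG)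

end SemiGraph.SubgroupPresentation

namespace ProfiniteSemiGraph

namespace GaloisLevelData

variable {𝒢 : ProfiniteSemiGraph.{u}} (D : GaloisLevelData 𝒢) (h𝒢 : 𝒢.IsCountable)
  (hconn : ∀ (n : ℕ) (p q : (D.S n).Point), (D.S n).SameComponent p q)
  (T : ∀ w : 𝒢.graph.Vertex, D.PointSeq h𝒢 w) (R : SemiGraph.RefBranches 𝒢.graph)

/-! ### The projections `π_n : π₁^temp(𝒢) ↠ Aut(S n)` -/

/-- The covering map `𝒢_{∞,n} → 𝒢_{S n}` (abc-iut-L3-t9's `univCoverOverProj`).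
[cite: MochizukiSemiAnbd2006, Prop 3.6 p.38] -/
noncomputable def levelProj (n : ℕ) : D.cover h𝒢 n ⟶ D.S n :=
  (D.S n).univCoverOverProj (Sum.inl (D.W n)) h𝒢

/-- The descent `Gal(𝒢_{∞,n}/𝒢) ↠ Aut(S n)` (abc-iut-L3-t9's `descendBaseAut`), typed on `Aut(𝒢_{∞,n})`.
[cite: MochizukiSemiAnbd2006, Prop 3.6 p.38] -/
noncomputable def descAut (n : ℕ) : Aut (D.cover h𝒢 n) →* Aut (D.S n) :=
  (D.S n).descendBaseAut h𝒢 (D.W n) (D.htrans n) (hconn n)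

/-- `descAut` is `descendBaseAut`. [cite: MochizukiSemiAnbd2006, Prop 3.6 p.38] -/
theorem descAut_apply (n : ℕ) (σ : Aut (D.cover h𝒢 n)) :
    D.descAut h𝒢 hconn n σ = (D.S n).descendBaseAut h𝒢 (D.W n) (D.htrans n) (hconn n) σ := rfl

/-- The descent square `σ ≫ levelProj = levelProj ≫ descAut σ`. [cite: MochizukiSemiAnbd2006, Prop 3.6 p.38] -/
theorem descAut_sq (n : ℕ) (σ : Aut (D.cover h𝒢 n)) :
    σ.hom ≫ D.levelProj h𝒢 n = D.levelProj h𝒢 n ≫ (D.descAut h𝒢 hconn n σ).hom :=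
  (D.S n).aut_hom_comp_univCoverOverProj h𝒢 (D.W n) (D.htrans n) (hconn n) σ

/-- **`π_n : π₁^temp(𝒢) → Aut(S n)`**, the action on the `n`-th finite Galois covering.
[cite: MochizukiSemiAnbd2006, Thm 3.7(iii) p.41] -/
noncomputable def piLevelAut (n : ℕ) : D.temperedPi h𝒢 →* Aut (D.S n) :=
  (D.descAut h𝒢 hconn n).comp (D.projAut h𝒢 n)

/-- `π_n = descAut ∘ ρ_n`, pointwise. [cite: MochizukiSemiAnbd2006, Thm 3.7(iii) p.41] -/
theorem piLevelAut_apply (n : ℕ) (g : D.temperedPi h𝒢) :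
    D.piLevelAut h𝒢 hconn n g = D.descAut h𝒢 hconn n (D.projAut h𝒢 n g) := rfl

/-- `π_n` is surjective. [cite: MochizukiSemiAnbd2006, Prop 3.6 p.38] -/
theorem piLevelAut_surjective (n : ℕ) : Function.Surjective (D.piLevelAut h𝒢 hconn n) :=
  ((D.S n).descendBaseAut_surjective h𝒢 (D.W n) (D.htrans n) (hconn n)).comp (D.projAut_surjective h𝒢 n)

/-- abc-iut-L3-t6's `levelAct n g` is `𝔾(π_n g)` on the underlying semi-graph (definitional).
[cite: MochizukiSemiAnbd2006, Thm 3.7(iii) p.41] -/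
theorem levelAct_hom_eq_piLevelAut (n : ℕ) (g : D.temperedPi h𝒢) :
    (D.levelAct h𝒢 hconn n g).hom = CovObj.orbitGraphMap (D.piLevelAut h𝒢 hconn n g).hom := rfl

/-- `ker ρ_n ≤ ker π_n`. [cite: MochizukiSemiAnbd2006, Prop 3.6 p.38] -/
theorem ker_projAut_le_ker_piLevelAut (n : ℕ) : (D.projAut h𝒢 n).ker ≤ (D.piLevelAut h𝒢 hconn n).ker := by
  intro g hg
  rw [MonoidHom.mem_ker] at hg ⊢
  rw [piLevelAut_apply, hg, map_one]

/-- `stepCover` lies over the finite-level transition: `(𝒢_{∞,n+1} → 𝒢_{∞,n} → 𝒢_{S n}) =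
(𝒢_{∞,n+1} → 𝒢_{S (n+1)} → 𝒢_{S n})`. [cite: MochizukiSemiAnbd2006, Prop 3.6 p.38] -/
theorem stepCover_levelProj (n : ℕ) :
    D.stepCover h𝒢 n ≫ D.levelProj h𝒢 n = D.levelProj h𝒢 (n + 1) ≫ D.g n := by
  have key : ∀ {V V' : (D.S n).OVertex} (p : V = V'),
      eqToHom (congrArg (fun V => (D.S n).univCoverOver (Sum.inl V) h𝒢) p) ≫
          (D.S n).univCoverOverProj (Sum.inl V') h𝒢 = (D.S n).univCoverOverProj (Sum.inl V) h𝒢 := by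
    rintro V _ rfl
    exact Category.id_comp _
  have e1 : (D.baseIso h𝒢 n).hom ≫ D.levelProj h𝒢 n =
      (D.S n).univCoverOverProj (Sum.inl (CovObj.OVertex.map (D.g n) (D.W (n + 1)))) h𝒢 := key (D.hW n)
  have e2 : CovObj.projOver (D.g n) (D.W (n + 1)) h𝒢 ≫
      (D.S n).univCoverOverProj (Sum.inl (CovObj.OVertex.map (D.g n) (D.W (n + 1)))) h𝒢 =
        D.levelProj h𝒢 (n + 1) ≫ D.g n :=
    CovObj.univCoverOverMap_comp_proj (D.g n) (Sum.inl (D.W (n + 1))) h𝒢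
  change (CovObj.projOver (D.g n) (D.W (n + 1)) h𝒢 ≫ (D.baseIso h𝒢 n).hom) ≫ D.levelProj h𝒢 n = _
  rw [Category.assoc, e1]
  exact e2

/-- `ker π_{n+1} ≤ ker π_n`: an element acting trivially on `S (n+1)` acts trivially on `S n` (rigidity of
the coverings and uniqueness of descent). [cite: MochizukiSemiAnbd2006, Prop 3.6 p.38] -/
theorem ker_piLevelAut_succ_le (n : ℕ) :
    (D.piLevelAut h𝒢 hconn (n + 1)).ker ≤ (D.piLevelAut h𝒢 hconn n).ker := by
  intro g hg
  rw [MonoidHom.mem_ker] at hg ⊢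
  have h1 : (D.projAut h𝒢 (n + 1) g).hom ≫ D.levelProj h𝒢 (n + 1) = D.levelProj h𝒢 (n + 1) := by
    rw [D.descAut_sq h𝒢 hconn (n + 1), ← piLevelAut_apply, hg]
    exact Category.comp_id _
  have hs : (D.projAut h𝒢 (n + 1) g).hom ≫ D.stepCover h𝒢 n =
      D.stepCover h𝒢 n ≫ (D.projAut h𝒢 n g).hom := by
    have h := D.hom_comp_stepCover h𝒢 n (D.proj h𝒢 (n + 1) g)
    rw [D.step_proj h𝒢 n g] at h
    exact h
  have h2 : D.stepCover h𝒢 n ≫ (D.projAut h𝒢 n g).hom ≫ D.levelProj h𝒢 n =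
      D.stepCover h𝒢 n ≫ D.levelProj h𝒢 n := by
    rw [← Category.assoc, ← hs, Category.assoc, D.stepCover_levelProj h𝒢 n, ← Category.assoc, h1]
  have h3 : (D.projAut h𝒢 n g).hom ≫ D.levelProj h𝒢 n = D.levelProj h𝒢 n := by
    obtain ⟨t₀⟩ := (D.S (n + 1)).nonempty_fibV_base (D.W (n + 1))
    refine (D.cover h𝒢 n).hom_eq_of_fV_apply_eq (D.cover_sameComponent h𝒢 n) _ _
      (((D.stepCover h𝒢 n).fV _).hom.hom t₀) ?_
    exact congrArg (fun φ : D.cover h𝒢 (n + 1) ⟶ D.S n => (φ.fV _).hom.hom t₀) h2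
  have h4 : (D.descAut h𝒢 hconn n (D.projAut h𝒢 n g)).hom = 𝟙 (D.S n) :=
    ((D.S n).descendBase_eq_id_iff h𝒢 (D.W n) (D.htrans n) (hconn n) _).mpr h3
  rw [piLevelAut_apply]
  exact Iso.ext h4

/-- `ker π_n` is open in `π₁^temp(𝒢)`. [cite: MochizukiSemiAnbd2006, Thm 3.7(iii) p.41] -/
theorem isOpen_ker_piLevelAut (n : ℕ) : IsOpen ((D.piLevelAut h𝒢 hconn n).ker : Set (D.temperedPi h𝒢)) :=
  Subgroup.isOpen_mono (D.ker_projAut_le_ker_piLevelAut h𝒢 hconn n) (D.isOpen_ker_proj h𝒢 n)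

/-! ### The point presentation of `S n` -/

/-- The base points of `S n`: the images of the `n`-th points of the sequences.
[cite: MochizukiSemiAnbd2006, Thm 3.7(iii) p.41] -/
noncomputable def ptS (n : ℕ) (w : 𝒢.graph.Vertex) : ((D.S n).SV w).obj.V :=
  ((D.levelProj h𝒢 n).fV w).hom.hom ((T w).pt n)

/-- The point data of `S n` (same reference branches `R`). [cite: MochizukiSemiAnbd2006, Thm 3.7(iii) p.41] -/
noncomputable def ptDataS (n : ℕ) : (D.S n).PtData := (D.ptData h𝒢 T R n).withPts (D.ptS h𝒢 T n)

/-- **The point presentation of `𝔾` inside `Aut(S n)`.** [cite: MochizukiSemiAnbd2006, Rmk. 2.2.1 p.24] -/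
@[reducible] noncomputable def levelPresS (n : ℕ) :
    SemiGraph.SubgroupPresentation 𝒢.graph (Aut (D.S n)) :=
  (D.ptDataS h𝒢 T R n).ptPresentation (hconn n) (D.htrans n)

/-- `π_n` carries the vertex subgroups of the presentation onto those of the point presentation of `S n`.
[cite: MochizukiSemiAnbd2006, Thm 3.7(iii) p.41] -/
theorem map_piLevelAut_H (n : ℕ) (w : 𝒢.graph.Vertex) :
    ((D.piPresentation h𝒢 T R).H w).map (D.piLevelAut h𝒢 hconn n) = (D.levelPresS h𝒢 hconn T R n).H w := by
  change ((D.piPresentation h𝒢 T R).H w).map ((D.descAut h𝒢 hconn n).comp (D.projAut h𝒢 n)) = _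
  rw [← Subgroup.map_map, D.map_projAut_H h𝒢 T R n w]
  exact (D.ptData h𝒢 T R n).map_desc_H (D.levelProj h𝒢 n) (D.cover_sameComponent h𝒢 n)
    (D.cover_htrans h𝒢 n) (hconn n) (D.htrans n) (D.descAut h𝒢 hconn n) (D.descAut_sq h𝒢 hconn n)
    (D.ptS h𝒢 T n) (fun _ => rfl) w

/-- … the edge subgroups … [cite: MochizukiSemiAnbd2006, Thm 3.7(iii) p.41] -/
theorem map_piLevelAut_M (n : ℕ) (e : 𝒢.graph.Edge) :
    ((D.piPresentation h𝒢 T R).M e).map (D.piLevelAut h𝒢 hconn n) = (D.levelPresS h𝒢 hconn T R n).M e := by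
  change ((D.piPresentation h𝒢 T R).M e).map ((D.descAut h𝒢 hconn n).comp (D.projAut h𝒢 n)) = _
  rw [← Subgroup.map_map, D.map_projAut_M h𝒢 T R n e]
  exact (D.ptData h𝒢 T R n).map_desc_M (D.levelProj h𝒢 n) (D.cover_sameComponent h𝒢 n)
    (D.cover_htrans h𝒢 n) (hconn n) (D.htrans n) (D.descAut h𝒢 hconn n) (D.descAut_sq h𝒢 hconn n)
    (D.ptS h𝒢 T n) (fun _ => rfl) e

/-- … and the branch elements. [cite: MochizukiSemiAnbd2006, Thm 3.7(iii) p.41] -/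
theorem piLevelAut_s (n : ℕ) (b : 𝒢.graph.Branch) :
    D.piLevelAut h𝒢 hconn n ((D.piPresentation h𝒢 T R).s b) = (D.levelPresS h𝒢 hconn T R n).s b := by
  rw [piLevelAut_apply, D.projAut_s h𝒢 T R n b]
  exact (D.ptData h𝒢 T R n).desc_brElt (D.levelProj h𝒢 n) (D.cover_sameComponent h𝒢 n)
    (D.cover_htrans h𝒢 n) (hconn n) (D.htrans n) (D.descAut h𝒢 hconn n) (D.descAut_sq h𝒢 hconn n)
    (D.ptS h𝒢 T n) (fun _ => rfl) b

/-- The image of `ker π_n` under `π_n` is trivial. [cite: MochizukiSemiAnbd2006, Prop 3.6 p.38] -/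
theorem map_ker_piLevelAut (n : ℕ) :
    ((D.piLevelAut h𝒢 hconn n).ker).map (D.piLevelAut h𝒢 hconn n) = ⊥ :=
  (Subgroup.map_eq_bot_iff _).mpr le_rfl

/-! ### The identification `cosetGraph (ker π_n) ≅ 𝔾_{S n}` -/

/-- The comparison morphism `(piPresentation).cosetGraph (ker π_n) ⟶ (levelPresS n).cosetGraph ⊥`
(`y ↦ π_n y`). [cite: MochizukiSemiAnbd2006, Thm 3.7(iii) p.41] -/
noncomputable def levelCosetHom (n : ℕ) :
    (D.piPresentation h𝒢 T R).cosetGraph (D.piLevelAut h𝒢 hconn n).ker ⟶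
      (D.levelPresS h𝒢 hconn T R n).cosetGraph ⊥ :=
  SemiGraph.SubgroupPresentation.cosetGraphMapTo _ _ (D.piLevelAut h𝒢 hconn n) _ ⊥
    (D.map_piLevelAut_H h𝒢 hconn T R n) (D.map_piLevelAut_M h𝒢 hconn T R n) (D.piLevelAut_s h𝒢 hconn T R n)
    (D.map_ker_piLevelAut h𝒢 hconn n)

/-- **The finite level `𝔾_{S n}` is the coset semi-graph of `π₁^temp(𝒢)` at the level `ker π_n`.**
[cite: MochizukiSemiAnbd2006, Thm 3.7(iii) p.41] -/
noncomputable def levelCosetIso (n : ℕ) :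
    (D.piPresentation h𝒢 T R).cosetGraph (D.piLevelAut h𝒢 hconn n).ker ≅ (D.S n).orbitGraph :=
  SemiGraph.SubgroupPresentation.cosetGraphIsoTo _ _ (D.piLevelAut h𝒢 hconn n) _ ⊥
      (D.map_piLevelAut_H h𝒢 hconn T R n) (D.map_piLevelAut_M h𝒢 hconn T R n) (D.piLevelAut_s h𝒢 hconn T R n)
      (D.map_ker_piLevelAut h𝒢 hconn n) (D.piLevelAut_surjective h𝒢 hconn n) le_rfl ≪≫
    (D.ptDataS h𝒢 T R n).cosetGraphIsoOrbitGraph (hconn n) (D.htrans n)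

/-- The `hom` of the identification. [cite: MochizukiSemiAnbd2006, Thm 3.7(iii) p.41] -/
theorem levelCosetIso_hom (n : ℕ) :
    (D.levelCosetIso h𝒢 hconn T R n).hom =
      D.levelCosetHom h𝒢 hconn T R n ≫ (D.ptDataS h𝒢 T R n).toOrbitGraph (hconn n) (D.htrans n) := rfl

/-- **The identification is over `𝔾`.** [cite: MochizukiSemiAnbd2006, Thm 3.7(iii) p.41] -/
theorem levelCosetIso_hom_comp_orbitGraphProj (n : ℕ) :
    (D.levelCosetIso h𝒢 hconn T R n).hom ≫ (D.S n).orbitGraphProj =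
      (D.piPresentation h𝒢 T R).cosetGraphProj (D.piLevelAut h𝒢 hconn n).ker := by
  rw [levelCosetIso_hom, Category.assoc, CovObj.PtData.toOrbitGraph_comp_proj]
  exact SemiGraph.SubgroupPresentation.cosetGraphMapTo_comp_proj _ _ _ _ _ _ _ _ _

/-! ### The universal graph-coverings `𝒢_{∞,n} → 𝔾_{S n}` are the transitions `ker ρ_n ≤ ker π_n` -/

/-- abc-iut-L3-t6's `treeIso` followed by `treeQuot` is `𝔾(levelProj n)`. [cite: MochizukiSemiAnbd2006, Prop 3.6 p.38] -/
theorem treeIso_hom_comp_treeQuot (n : ℕ) :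
    (D.treeIso h𝒢 n).hom ≫ D.treeQuot n = CovObj.orbitGraphMap (D.levelProj h𝒢 n) :=
  (D.S n).univCoverOverToUnivCover_comp_univCoverProj (Sum.inl (D.W n)) h𝒢

/-- The push morphism of part 3 at level `n` (along `descAut`). [cite: MochizukiSemiAnbd2006, Thm 3.7(iii) p.41] -/
noncomputable def levelPushHom (n : ℕ) :
    (D.levelPres h𝒢 T R n).cosetGraph ⊥ ⟶ (D.levelPresS h𝒢 hconn T R n).cosetGraph ⊥ :=
  (D.ptData h𝒢 T R n).pushHom (D.levelProj h𝒢 n) (D.cover_sameComponent h𝒢 n) (D.cover_htrans h𝒢 n)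
    (hconn n) (D.htrans n) (D.descAut h𝒢 hconn n) (D.descAut_sq h𝒢 hconn n) (D.ptS h𝒢 T n) (fun _ => rfl)

/-- The comparison morphisms to the orbit graphs commute with `𝔾(levelProj n)`.
[cite: MochizukiSemiAnbd2006, Thm 3.7(iii) p.41] -/
theorem toOrbitGraph_levelProj (n : ℕ) :
    (D.ptData h𝒢 T R n).toOrbitGraph (D.cover_sameComponent h𝒢 n) (D.cover_htrans h𝒢 n) ≫
        CovObj.orbitGraphMap (D.levelProj h𝒢 n) =
      D.levelPushHom h𝒢 hconn T R n ≫ (D.ptDataS h𝒢 T R n).toOrbitGraph (hconn n) (D.htrans n) :=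
  (D.ptData h𝒢 T R n).toOrbitGraph_push (D.levelProj h𝒢 n) (D.cover_sameComponent h𝒢 n)
    (D.cover_htrans h𝒢 n) (hconn n) (D.htrans n) (D.descAut h𝒢 hconn n) (D.descAut_sq h𝒢 hconn n)
    (D.ptS h𝒢 T n) (fun _ => rfl)

/-- `ρ_n` followed by `descAut` is `π_n`, on coset semi-graphs. [cite: MochizukiSemiAnbd2006, Thm 3.7(iii) p.41] -/
theorem treeCosetHom_levelPushHom (n : ℕ) :
    D.treeCosetHom h𝒢 T R n ≫ D.levelPushHom h𝒢 hconn T R n =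
      (D.piPresentation h𝒢 T R).cosetGraphTrans (D.ker_projAut_le_ker_piLevelAut h𝒢 hconn n) ≫
        D.levelCosetHom h𝒢 hconn T R n :=
  (D.piPresentation h𝒢 T R).hom_ext_mk _ _ _ (fun _ _ => rfl) (fun _ _ => rfl) (fun _ _ => rfl)

/-- **The `quot` dictionary**: under the identifications, abc-iut-L3-t6's universal graph-covering
`treeQuot n : 𝒢_{∞,n} → 𝔾_{S n}` is the transition `cosetGraphTrans (ker ρ_n ≤ ker π_n)`.
[cite: MochizukiSemiAnbd2006, Thm 3.7(iii) p.41] -/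
theorem treeCosetIso_quot (n : ℕ) :
    (D.treeCosetIso h𝒢 T R n).hom ≫ D.treeQuot n =
      (D.piPresentation h𝒢 T R).cosetGraphTrans (D.ker_projAut_le_ker_piLevelAut h𝒢 hconn n) ≫
        (D.levelCosetIso h𝒢 hconn T R n).hom := by
  rw [D.treeCosetIso_hom h𝒢 T R n, Category.assoc, Category.assoc, D.treeIso_hom_comp_treeQuot h𝒢 n,
    D.toOrbitGraph_levelProj h𝒢 hconn T R n, ← Category.assoc, D.treeCosetHom_levelPushHom h𝒢 hconn T R n,
    Category.assoc, levelCosetIso_hom]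

/-! ### Equivariance -/

/-- **The identification intertwines the deck action of `π₁^temp(𝒢)` on the coset semi-graph with
abc-iut-L3-t6's `levelAct` on `𝔾_{S n}`.** [cite: MochizukiSemiAnbd2006, Thm 3.7(iii) p.41] -/
theorem deckAct_comp_levelCosetIso (n : ℕ) (g : D.temperedPi h𝒢) :
    ((D.piPresentation h𝒢 T R).deckAct (D.piLevelAut h𝒢 hconn n).ker g).hom ≫
        (D.levelCosetIso h𝒢 hconn T R n).hom =
      (D.levelCosetIso h𝒢 hconn T R n).hom ≫ (D.levelAct h𝒢 hconn n g).hom := by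
  rw [levelCosetIso_hom, ← Category.assoc]
  change (_ ≫ SemiGraph.SubgroupPresentation.cosetGraphMapTo _ _ _ _ _ _ _ _ _) ≫ _ = _
  rw [SemiGraph.SubgroupPresentation.deckAct_comp_cosetGraphMapTo, Category.assoc]
  change _ ≫ (((D.ptDataS h𝒢 T R n).ptPresentation _ _).deckAct ⊥ (D.piLevelAut h𝒢 hconn n g)).hom ≫
    (D.ptDataS h𝒢 T R n).toOrbitGraph _ _ = _
  rw [CovObj.PtData.deckAct_comp_toOrbitGraph, ← Category.assoc]
  rfl

/-! ### Compatibility with the finite-level transitions -/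

/-- **The identifications are compatible with the transitions of the finite levels**: the transition
`cosetGraphTrans (ker π_{n+1} ≤ ker π_n)` corresponds to `𝔾(S (n+1) → S n)` (abc-iut-L3-t6's
`levelTrans`). [cite: MochizukiSemiAnbd2006, Thm 3.7(iii) p.41] -/
theorem levelCosetIso_trans (n : ℕ) :
    (D.levelCosetIso h𝒢 hconn T R (n + 1)).hom ≫ CovObj.orbitGraphMap (D.g n) =
      (D.piPresentation h𝒢 T R).cosetGraphTrans (D.ker_piLevelAut_succ_le h𝒢 hconn n) ≫
        (D.levelCosetIso h𝒢 hconn T R n).hom := by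
  refine (D.piPresentation h𝒢 T R).cancel_cosetGraphTrans
    (D.ker_projAut_le_ker_piLevelAut h𝒢 hconn (n + 1)) _ _ ?_
  rw [← Category.assoc, ← D.treeCosetIso_quot h𝒢 hconn T R (n + 1), Category.assoc,
    ← D.treeStep_quot n, ← Category.assoc, D.treeCosetIso_trans h𝒢 T R n, Category.assoc,
    D.treeCosetIso_quot h𝒢 hconn T R n, ← Category.assoc, ← Category.assoc,
    SemiGraph.SubgroupPresentation.cosetGraphTrans_comp, SemiGraph.SubgroupPresentation.cosetGraphTrans_comp]

end GaloisLevelData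

end ProfiniteSemiGraph

end Literature.AnabelianGeometry.SemiGraphs
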